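import Summits.HubbardSuperconductivity.HubbardSuperconductivity.Theorems.WeakCouplingBCSKlLindhardEnclosureTwoShell

/-!
# KL-MARGIN-SCAN reader (22) «kernel-lindhard-enclosure» — the CHORD ceiling rule DISCHARGED

Third of the five remaining rule-level debts paid in full, for EVERY parameter record `P` and with NO side condition:
`ceilChordSoundOrd : ∀ P, CeilChordSoundOrd P`.  Content: on a guarded, oriented, SQUARE two-shell cell of kind `k` inside the root square
(`dz = b − a = d − c > 0`, statuses `(some k, some !k)`), the two-shell integrand is `F = 1/g_k` with `glo = Glo/2^40 ≤ g_k ≤ ghi = Ghi/2^40`,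
`0 < Glo` (`…TwoShell`); the CHORD of the convex function `1/x` gives `F ≤ (glo + ghi − g_k)/(glo·ghi)` pointwise, so
`∫_cell F ≤ (h²(glo+ghi) − ∫_cell g_k)/(glo·ghi)`; and `4·2^40·∫_cell g_k ≥ h²·M`, `M = max(4·Glo, Σ gCornerLo − interpE)` (corner-mean lemma
with the kernel's slack, and the trivial bound), whence `2^30 ∫_cell F ≤ 2^28·2^40·dz²·(4Glo + 4Ghi − M)/(U²·Glo·Ghi) ≤ cdivZ (…) (…)` =
the kernel's chord numerator.  With `…SameSide` and `…Crude`, the CEILING debt of `CeilSoundAt P t` (all trees) is now exactly the two rules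
majorised hyperbola / tip (`ceilSoundAt_of_two_rules`).  Honest framing: nothing in this file asserts a KL margin at any `t′ ≠ 0`, `K₃`, `U₀`,
the window or B1g dominance; a Kohn–Luttinger instability statement is not ODLRO and nothing here proves superconductivity in the Hubbard
model.  (p1 g26, 2026-08-29.)
-/

noncomputable section

set_option linter.dupNamespace false

namespace Summit.HubbardSuperconductivity.HubbardSuperconductivity.Theorems.KlLindhardEnclosure

open Real Set MeasureTheory Literature.MathematicalPhysics.QuantumLattice
open Summit.HubbardSuperconductivity.HubbardSuperconductivity.Theorems

/-- **THE CHORD OF `1/x`**: for `0 < lo ≤ x ≤ hi`, `1/x ≤ (lo + hi − x)/(lo·hi)` (convexity of `x ↦ 1/x`). -/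
theorem inv_le_chord {lo hi x : ℝ} (hlo : 0 < lo) (h1 : lo ≤ x) (h2 : x ≤ hi) : 1 / x ≤ (lo + hi - x) / (lo * hi) := by
  have hx : 0 < x := lt_of_lt_of_le hlo h1
  have hhi : 0 < hi := lt_of_lt_of_le hx h2
  rw [div_le_div_iff₀ hx (mul_pos hlo hhi)]
  nlinarith [mul_nonneg (sub_nonneg.2 h1) (sub_nonneg.2 h2)]

/-- **THE CHORD CORE**: on a guarded, oriented, square two-shell cell of kind `k` inside the root square with `0 < Glo ≤ Ghi`, the kernel's
chord numerator is a certified ceiling of the cell. -/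
theorem Params.chord_core (P : Params) (hP : P.admissible = true) {a b c d : ℤ} (hin : P.InRoot a b c d) (hab : a ≤ b) (hcd : c ≤ d)
    {k : Bool} (hg : (P.cell (P.mkX a) (P.mkX b) (P.mkY c) (P.mkY d)).guards = true)
    (hs1 : P.status (P.cell (P.mkX a) (P.mkX b) (P.mkY c) (P.mkY d)).e1Lo (P.cell (P.mkX a) (P.mkX b) (P.mkY c) (P.mkY d)).e1Hi = some k)
    (hs2 : P.status (P.cell (P.mkX a) (P.mkX b) (P.mkY c) (P.mkY d)).e2Lo (P.cell (P.mkX a) (P.mkX b) (P.mkY c) (P.mkY d)).e2Hi = some (!k))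
    (hGG : (P.cell (P.mkX a) (P.mkX b) (P.mkY c) (P.mkY d)).gLo k ≤ (P.cell (P.mkX a) (P.mkX b) (P.mkY c) (P.mkY d)).gHi k)
    (hsq : d - c = b - a) (hdz : 0 < b - a) :
    P.CeilValid a b c d (cdivZ (2 ^ 28 * D * (b - a) ^ 2 *
      (4 * (P.cell (P.mkX a) (P.mkX b) (P.mkY c) (P.mkY d)).gLo k + 4 * (P.cell (P.mkX a) (P.mkX b) (P.mkY c) (P.mkY d)).gHi k -
        max (4 * (P.cell (P.mkX a) (P.mkX b) (P.mkY c) (P.mkY d)).gLo k)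
          (P.gCornerLo k (P.mkX a) (P.mkY c) + P.gCornerLo k (P.mkX b) (P.mkY c) + P.gCornerLo k (P.mkX a) (P.mkY d) +
            P.gCornerLo k (P.mkX b) (P.mkY d) - P.interpE (b - a))))
      (P.U ^ 2 * (P.cell (P.mkX a) (P.mkX b) (P.mkY c) (P.mkY d)).gLo k * (P.cell (P.mkX a) (P.mkX b) (P.mkY c) (P.mkY d)).gHi k)) := by
  obtain ⟨htpD, hmuD, hU, -, -⟩ := P.admissible_facts hP
  have hU' : (0 : ℝ) < (P.U : ℝ) := by exact_mod_cast hU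
  have hGlo := P.gLo_pos hP hs1 hs2
  -- integer data as reals
  have hGlo' : (0 : ℝ) < (((P.cell (P.mkX a) (P.mkX b) (P.mkY c) (P.mkY d)).gLo k : ℤ) : ℝ) := by exact_mod_cast hGlo
  have hGG' : (((P.cell (P.mkX a) (P.mkX b) (P.mkY c) (P.mkY d)).gLo k : ℤ) : ℝ) ≤
      (((P.cell (P.mkX a) (P.mkX b) (P.mkY c) (P.mkY d)).gHi k : ℤ) : ℝ) := by exact_mod_cast hGG
  have hGhi' : (0 : ℝ) < (((P.cell (P.mkX a) (P.mkX b) (P.mkY c) (P.mkY d)).gHi k : ℤ) : ℝ) := lt_of_lt_of_le hGlo' hGG'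
  have hglo : (0 : ℝ) < (((P.cell (P.mkX a) (P.mkX b) (P.mkY c) (P.mkY d)).gLo k : ℤ) : ℝ) / 2 ^ 40 := by positivity
  have hghi : (0 : ℝ) < (((P.cell (P.mkX a) (P.mkX b) (P.mkY c) (P.mkY d)).gHi k : ℤ) : ℝ) / 2 ^ 40 := by positivity
  have hint := P.twoShell_integrableOn hP hin hg hs1 hs2
  refine ⟨hint, ?_⟩
  have hmeas := P.measurableSet_cellSet a b c d
  have hvol := (P.volume_cellSet_lt_top a b c d).ne
  -- (1) the chord, pointwise, then integrated
  have hchordInt : IntegrableOn (fun p => ((((P.cell (P.mkX a) (P.mkX b) (P.mkY c) (P.mkY d)).gLo k : ℤ) : ℝ) / 2 ^ 40 +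
      (((P.cell (P.mkX a) (P.mkX b) (P.mkY c) (P.mkY d)).gHi k : ℤ) : ℝ) / 2 ^ 40 - P.gfun k p) /
      (((((P.cell (P.mkX a) (P.mkX b) (P.mkY c) (P.mkY d)).gLo k : ℤ) : ℝ) / 2 ^ 40) *
        ((((P.cell (P.mkX a) (P.mkX b) (P.mkY c) (P.mkY d)).gHi k : ℤ) : ℝ) / 2 ^ 40))) (P.cellSet a b c d) volume :=
    ((integrableOn_const (hs := hvol)).sub (P.gfun_integrableOn k a b c d)).div_const _
  have h1 : P.cellInt a b c d ≤ ∫ p in P.cellSet a b c d, ((((P.cell (P.mkX a) (P.mkX b) (P.mkY c) (P.mkY d)).gLo k : ℤ) : ℝ) / 2 ^ 40 +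
      (((P.cell (P.mkX a) (P.mkX b) (P.mkY c) (P.mkY d)).gHi k : ℤ) : ℝ) / 2 ^ 40 - P.gfun k p) /
      (((((P.cell (P.mkX a) (P.mkX b) (P.mkY c) (P.mkY d)).gLo k : ℤ) : ℝ) / 2 ^ 40) *
        ((((P.cell (P.mkX a) (P.mkX b) (P.mkY c) (P.mkY d)).gHi k : ℤ) : ℝ) / 2 ^ 40)) := by
    unfold Params.cellInt
    refine setIntegral_mono_on hint hchordInt hmeas fun p hp => ?_
    rw [P.twoShell_integrand_eq hP hin hg hs1 hs2 hp]
    obtain ⟨l, u, _⟩ := P.twoShell_gfun_mem hP hin hg hs1 hs2 hp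
    exact inv_le_chord hglo l u
  -- (2) evaluate the chord integral
  have hcI : IntegrableOn (fun _ : Momentum => ((((P.cell (P.mkX a) (P.mkX b) (P.mkY c) (P.mkY d)).gLo k : ℤ) : ℝ) / 2 ^ 40 +
      (((P.cell (P.mkX a) (P.mkX b) (P.mkY c) (P.mkY d)).gHi k : ℤ) : ℝ) / 2 ^ 40)) (P.cellSet a b c d) volume :=
    integrableOn_const (hs := hvol)
  have h2 : (∫ p in P.cellSet a b c d, ((((P.cell (P.mkX a) (P.mkX b) (P.mkY c) (P.mkY d)).gLo k : ℤ) : ℝ) / 2 ^ 40 +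
      (((P.cell (P.mkX a) (P.mkX b) (P.mkY c) (P.mkY d)).gHi k : ℤ) : ℝ) / 2 ^ 40 - P.gfun k p) /
      (((((P.cell (P.mkX a) (P.mkX b) (P.mkY c) (P.mkY d)).gLo k : ℤ) : ℝ) / 2 ^ 40) *
        ((((P.cell (P.mkX a) (P.mkX b) (P.mkY c) (P.mkY d)).gHi k : ℤ) : ℝ) / 2 ^ 40)))
      = (((b : ℝ) - (a : ℝ)) * ((d : ℝ) - (c : ℝ)) / ((P.U : ℝ) ^ 2) *
          ((((P.cell (P.mkX a) (P.mkX b) (P.mkY c) (P.mkY d)).gLo k : ℤ) : ℝ) / 2 ^ 40 +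
            (((P.cell (P.mkX a) (P.mkX b) (P.mkY c) (P.mkY d)).gHi k : ℤ) : ℝ) / 2 ^ 40) -
          ∫ p in P.cellSet a b c d, P.gfun k p) /
        (((((P.cell (P.mkX a) (P.mkX b) (P.mkY c) (P.mkY d)).gLo k : ℤ) : ℝ) / 2 ^ 40) *
          ((((P.cell (P.mkX a) (P.mkX b) (P.mkY c) (P.mkY d)).gHi k : ℤ) : ℝ) / 2 ^ 40)) := by
    rw [integral_div, integral_sub hcI (P.gfun_integrableOn k a b c d), setIntegral_const,
      P.volumeReal_cellSet hU hab hcd, smul_eq_mul]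
  -- (3) lower bounds for the integral of g
  have h3a := P.integral_gfun_ge_gLo hP hin hab hcd hg hs1 hs2
  have h3b := (P.integral_gfun_corner_bounds hP k hin (by omega) hsq).1
  -- real bookkeeping
  have hsq' : ((d : ℝ) - (c : ℝ)) = ((b : ℝ) - (a : ℝ)) := by exact_mod_cast (by omega : d - c = b - a)
  have hdz' : (0 : ℝ) < (b : ℝ) - (a : ℝ) := by exact_mod_cast (by omega : (0 : ℤ) < b - a)
  have harea : (0 : ℝ) < ((b : ℝ) - (a : ℝ)) * ((d : ℝ) - (c : ℝ)) / ((P.U : ℝ) ^ 2) := by rw [hsq']; positivity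
  rw [hsq'] at h2 h3a harea
  have eh : (((b - a : ℤ) : ℝ) / (P.U : ℝ)) ^ 2 = ((b : ℝ) - (a : ℝ)) * ((b : ℝ) - (a : ℝ)) / ((P.U : ℝ) ^ 2) := by
    push_cast; ring
  rw [eh] at h3b
  -- the kernel's `M = max (4 Glo) (Σ gCornerLo − E)`, generalized
  generalize hMz : max (4 * (P.cell (P.mkX a) (P.mkX b) (P.mkY c) (P.mkY d)).gLo k)
      (P.gCornerLo k (P.mkX a) (P.mkY c) + P.gCornerLo k (P.mkX b) (P.mkY c) + P.gCornerLo k (P.mkX a) (P.mkY d) +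
        P.gCornerLo k (P.mkX b) (P.mkY d) - P.interpE (b - a)) = Mz
  have hM : ((b : ℝ) - (a : ℝ)) * ((b : ℝ) - (a : ℝ)) / ((P.U : ℝ) ^ 2) * ((Mz : ℤ) : ℝ)
        ≤ 4 * 2 ^ 40 * ∫ p in P.cellSet a b c d, P.gfun k p := by
    rw [← hMz]
    push_cast
    rw [mul_max_of_nonneg _ _ harea.le]
    refine max_le ?_ ?_
    · have := h3a; linarith
    · push_cast at h3b; linarith
  -- (4) combine
  have hGhiZ : 0 < (P.cell (P.mkX a) (P.mkX b) (P.mkY c) (P.mkY d)).gHi k := lt_of_lt_of_le hGlo hGG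
  have hden : 0 < P.U ^ 2 * (P.cell (P.mkX a) (P.mkX b) (P.mkY c) (P.mkY d)).gLo k *
      (P.cell (P.mkX a) (P.mkX b) (P.mkY c) (P.mkY d)).gHi k := by positivity
  have hden' : (0 : ℝ) < ((P.U ^ 2 * (P.cell (P.mkX a) (P.mkX b) (P.mkY c) (P.mkY d)).gLo k *
      (P.cell (P.mkX a) (P.mkX b) (P.mkY c) (P.mkY d)).gHi k : ℤ) : ℝ) := by exact_mod_cast hden
  have rc := div_le_cdivZ (2 ^ 28 * D * (b - a) ^ 2 *
      (4 * (P.cell (P.mkX a) (P.mkX b) (P.mkY c) (P.mkY d)).gLo k + 4 * (P.cell (P.mkX a) (P.mkX b) (P.mkY c) (P.mkY d)).gHi k - Mz))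
      (P.U ^ 2 * (P.cell (P.mkX a) (P.mkX b) (P.mkY c) (P.mkY d)).gLo k * (P.cell (P.mkX a) (P.mkX b) (P.mkY c) (P.mkY d)).gHi k) hden
  have rc' := (Rat.cast_le (K := ℝ)).mpr rc
  simp only [Rat.cast_div, Rat.cast_intCast] at rc'
  refine le_trans ?_ rc'
  rw [le_div_iff₀ hden']
  -- J ≤ (A (glo + ghi) − I)/(glo ghi)
  have hJ' : P.cellInt a b c d * (((((P.cell (P.mkX a) (P.mkX b) (P.mkY c) (P.mkY d)).gLo k : ℤ) : ℝ) / 2 ^ 40) *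
        ((((P.cell (P.mkX a) (P.mkX b) (P.mkY c) (P.mkY d)).gHi k : ℤ) : ℝ) / 2 ^ 40))
      ≤ ((b : ℝ) - (a : ℝ)) * ((b : ℝ) - (a : ℝ)) / ((P.U : ℝ) ^ 2) *
          ((((P.cell (P.mkX a) (P.mkX b) (P.mkY c) (P.mkY d)).gLo k : ℤ) : ℝ) / 2 ^ 40 +
            (((P.cell (P.mkX a) (P.mkX b) (P.mkY c) (P.mkY d)).gHi k : ℤ) : ℝ) / 2 ^ 40) -
          ∫ p in P.cellSet a b c d, P.gfun k p := by
    have := h1.trans (le_of_eq h2)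
    rwa [le_div_iff₀ (by positivity)] at this
  simp only [D]
  push_cast at hM ⊢
  set I := ∫ p in P.cellSet a b c d, P.gfun k p with hI
  set J := P.cellInt a b c d with hJ
  set Glo := (((P.cell (P.mkX a) (P.mkX b) (P.mkY c) (P.mkY d)).gLo k : ℤ) : ℝ) with hGloDef
  set Ghi := (((P.cell (P.mkX a) (P.mkX b) (P.mkY c) (P.mkY d)).gHi k : ℤ) : ℝ) with hGhiDef
  set M := ((Mz : ℤ) : ℝ) with hMdef
  set A := ((b : ℝ) - (a : ℝ)) * ((b : ℝ) - (a : ℝ)) / ((P.U : ℝ) ^ 2) with hA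
  have hU2 : ((P.U : ℝ) ^ 2) * A = ((b : ℝ) - (a : ℝ)) * ((b : ℝ) - (a : ℝ)) := by
    rw [hA]; field_simp
  have inner : 2 ^ 30 * J * (Glo * Ghi) ≤ 2 ^ 28 * 2 ^ 40 * A * (4 * Glo + 4 * Ghi - M) := by linarith [hJ', hM]
  have outer := mul_le_mul_of_nonneg_left inner (sq_nonneg (P.U : ℝ))
  have esq : ((b : ℝ) - (a : ℝ)) ^ 2 = ((P.U : ℝ) ^ 2) * A := by rw [hU2]; ring
  rw [esq]
  linarith [outer]

/-- **THE CHORD RULE HOLDS for every `P`.** -/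
theorem ceilChordSoundOrd (P : Params) : CeilChordSoundOrd P := by
  intro a b c d k u hP hin hab hcd hg hs1 hs2 hu
  cases k with
  | true =>
    simp only [Params.ceilChord, Params.mkX_z, Params.mkY_z, ↓reduceIte] at hu
    split_ifs at hu with hcond
    simp only [Option.some.injEq] at hu
    simp only [Bool.and_eq_true, decide_eq_true_eq] at hcond
    obtain ⟨⟨⟨hGlo, hGG⟩, hsq⟩, hdz⟩ := hcond
    subst hu
    have core := P.chord_core hP hin hab hcd hg hs1 hs2 (k := true) (by simpa [Cell.gLo, Cell.gHi] using hGG) hsq hdz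
    simpa [Cell.gLo, Cell.gHi] using core
  | false =>
    simp only [Params.ceilChord, Params.mkX_z, Params.mkY_z, Bool.false_eq_true, ↓reduceIte] at hu
    split_ifs at hu with hcond
    simp only [Option.some.injEq] at hu
    simp only [Bool.and_eq_true, decide_eq_true_eq] at hcond
    obtain ⟨⟨⟨hGlo, hGG⟩, hsq⟩, hdz⟩ := hcond
    subst hu
    have core := P.chord_core hP hin hab hcd hg hs1 hs2 (k := false) (by simpa [Cell.gLo, Cell.gHi] using hGG) hsq hdz
    simpa [Cell.gLo, Cell.gHi] using core

/-- **CEILING SOUNDNESS FROM THE TWO REMAINING RULES** (majorised hyperbola, tip), for every certificate tree. -/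
theorem ceilSoundAt_of_two_rules (P : Params) (hB : CeilBdrySoundOrd P) (hT : CeilTipSoundOrd P) (t : QB) : CeilSoundAt P t :=
  ceilSoundAt_of_three_rules P (ceilChordSoundOrd P) hB hT t

end Summit.HubbardSuperconductivity.HubbardSuperconductivity.Theorems.KlLindhardEnclosure

end
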